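/-
Copyright: literature formalisation for the harness. Statements follow the cited text.
-/
import Literature.AlgebraicGeometry.CossartPiltant200819.CoarseTower2008
import HarnessLib

/-!
# Cossart–Piltant I (2008), Thm 7.2 — clause T-a(ii)′: the purely inseparable climb

Sequel to `CoarseTower2008`. The proof of Thm 7.2 (HAL p. 20) writes the purely inseparable
part `K/K₁` (`K₁` the separable closure of `K₀ = k(x)` in `K`) as a tower of simple
extensions of degree `p`, `K₁ = K_{1,0} ⊂ K_{1,1} ⊂ ⋯ ⊂ K_{1,n} = K`, `K_{1,i+1} = K_{1,i}(ηᵢ₊₁)`,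
`ηᵢ₊₁ᵖ ∈ K_{1,i}`, and climbs it one `inseparableStep` at a time (the valuation ring of each
stage being `V ∩ K_{1,i}`, which is automatic: a purely inseparable extension has a unique
extension of every valuation ring, `TowerInheritance2008`).

PROVED here (kernel-checked, no `sorry`), in the abstract-stage idiom of `Tower2008`:

* `CReach3.of_isPurelyInseparable` — for `M/K` finite purely inseparable, `char k = p`,
  `k` imperfect, and ANY valuation ring `W` of `M` containing `k`:
  `CReach3 k ⟨K, W ∩ K⟩ ⟨M, W⟩`;
* `CReach3.of_finrank_eq_one`, `CReach3.of_bijective` — the degenerate case (`k` perfect and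
  `x` a separating transcendence basis, so that `K₁ = K`);
* `CReach3.of_isPurelyInseparable'` — the two cases merged under the hypothesis of
  `GaloisTowerExists2008` (`PerfectField k → [M : K] = 1`);
* the field-theoretic lemmas `exists_not_mem_bot_pow_eq` (an `η ∉ K` with `ηᵖ ∈ K` exists in a
  nontrivial purely inseparable extension), `finrank_adjoin_simple_eq_of_pow_eq`
  (`[K(η) : K] = p`), `adjoin_simple_gen_eq_top`.

So clause T-a(ii)′ (the purely inseparable filtration and its climb) of the residual of
`CoarseTowerExists2008` is discharged; what remains NAMED is the Galois side (Krull climb,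
`K^r/K^i`, the `p`-group segment) and the assembly. [cite: CossartPiltant2008, Thm 7.2 proof
(HAL p. 20)]
-/

namespace Literature.AlgebraicGeometry.CossartPiltant200819.CP2008

open Literature.AlgebraicGeometry.Resolution IsLocalRing Polynomial
open scoped Pointwise IntermediateField

universe u

section Stages

variable {k : Type u} [Field k]

/-- Stages on the same field with equal valuation rings are equal. [folklore] -/
theorem VState.mk_congr {K : Type u} [Field K] [Algebra k K] {O₁ O₂ : ValuationSubring K}
    (h : O₁ = O₂) (h₁ : ∀ c : k, algebraMap k K c ∈ O₁) (h₂ : ∀ c : k, algebraMap k K c ∈ O₂) :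
    (⟨K, O₁, h₁⟩ : VState k) = ⟨K, O₂, h₂⟩ := by
  subst h
  rfl

/-- Re-presentation of a stage along a `k`-isomorphism, forward. [folklore] -/
theorem CReach3.of_algEquiv {K₁ K₂ : Type u} [Field K₁] [Algebra k K₁] [Field K₂] [Algebra k K₂]
    (e : K₁ ≃ₐ[k] K₂) (O : ValuationSubring K₂) (hk : ∀ c : k, algebraMap k K₂ c ∈ O) :
    CReach3 k ⟨K₁, O.comap (e : K₁ →+* K₂), forall_algebraMap_mem_comap_algEquiv e hk⟩
      ⟨K₂, O, hk⟩ :=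
  Relation.ReflTransGen.single (CMove3.iso e O hk)

/-- Re-presentation of a stage along a `k`-isomorphism, backward. [folklore] -/
theorem CReach3.of_algEquiv_symm {K₁ K₂ : Type u} [Field K₁] [Algebra k K₁] [Field K₂]
    [Algebra k K₂] (e : K₁ ≃ₐ[k] K₂) (O : ValuationSubring K₂)
    (hk : ∀ c : k, algebraMap k K₂ c ∈ O) :
    CReach3 k ⟨K₂, O, hk⟩
      ⟨K₁, O.comap (e : K₁ →+* K₂), forall_algebraMap_mem_comap_algEquiv e hk⟩ := by
  have h := CMove3.iso (k := k) e.symm (O.comap (e : K₁ →+* K₂))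
    (forall_algebraMap_mem_comap_algEquiv e hk)
  have hO : (O.comap (e : K₁ →+* K₂)).comap (e.symm : K₂ →+* K₁) = O := by
    ext x
    simp [ValuationSubring.mem_comap]
  rw [VState.mk_congr hO _ hk] at h
  exact Relation.ReflTransGen.single h

/-- **Degenerate step**: if `K → M` is bijective, the stage `(K, W ∩ K)` reaches `(M, W)` (one
`iso` move). [folklore] -/
theorem CReach3.of_bijective {K M : Type u} [Field K] [Algebra k K] [Field M] [Algebra K M]
    [Algebra k M] [IsScalarTower k K M] (hb : Function.Bijective (algebraMap K M))
    (W : ValuationSubring M) (hkW : ∀ c : k, algebraMap k M c ∈ W) :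
    CReach3 k ⟨K, W.comap (algebraMap K M), forall_algebraMap_mem_comap hkW⟩ ⟨M, W, hkW⟩ := by
  let e : K ≃ₐ[k] M := AlgEquiv.ofBijective (IsScalarTower.toAlgHom k K M) hb
  have he : (e : K →+* M) = algebraMap K M := RingHom.ext fun x => rfl
  have h := CMove3.iso e W hkW
  rw [VState.mk_congr (congrArg W.comap he) _ (forall_algebraMap_mem_comap hkW)] at h
  exact Relation.ReflTransGen.single h

/-- **Degenerate step**: `[M : K] = 1`. [folklore] -/
theorem CReach3.of_finrank_eq_one {K M : Type u} [Field K] [Algebra k K] [Field M] [Algebra K M]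
    [Algebra k M] [IsScalarTower k K M] (h1 : Module.finrank K M = 1)
    (W : ValuationSubring M) (hkW : ∀ c : k, algebraMap k M c ∈ W) :
    CReach3 k ⟨K, W.comap (algebraMap K M), forall_algebraMap_mem_comap hkW⟩ ⟨M, W, hkW⟩ := by
  refine CReach3.of_bijective ⟨(algebraMap K M).injective, fun m => ?_⟩ W hkW
  have hbt : (⊥ : Subalgebra K M) = ⊤ := Subalgebra.bot_eq_top_iff_finrank_eq_one.mpr h1
  have hm : m ∈ (⊥ : Subalgebra K M) := hbt ▸ Algebra.mem_top
  exact Algebra.mem_bot.mp hm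

end Stages

section FieldLemmas

variable {K M : Type u} [Field K] [Field M] [Algebra K M]

/-- In a nontrivial purely inseparable extension of exponent characteristic `p` there is an
`η ∉ K` with `ηᵖ ∈ K`. [folklore] -/
theorem exists_not_mem_bot_pow_eq (p : ℕ) [ExpChar K p] [IsPurelyInseparable K M]
    (h : (⊥ : IntermediateField K M) ≠ ⊤) :
    ∃ η : M, η ∉ (⊥ : IntermediateField K M) ∧ ∃ b : K, η ^ p = algebraMap K M b := by
  classical
  obtain ⟨y, hy⟩ : ∃ y : M, y ∉ (⊥ : IntermediateField K M) := by
    by_contra h'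
    push Not at h'
    exact h (eq_top_iff.mpr fun y _ => h' y)
  have hex : ∃ m : ℕ, y ^ p ^ m ∈ (⊥ : IntermediateField K M) := by
    obtain ⟨m, c, hc⟩ := IsPurelyInseparable.pow_mem K p (x := y)
    exact ⟨m, IntermediateField.mem_bot.mpr ⟨c, hc⟩⟩
  have hm : y ^ p ^ Nat.find hex ∈ (⊥ : IntermediateField K M) := Nat.find_spec hex
  have hm0 : Nat.find hex ≠ 0 := by
    intro h0
    rw [h0, pow_zero, pow_one] at hm
    exact hy hm
  obtain ⟨m', hm'⟩ : ∃ m', Nat.find hex = m' + 1 := ⟨Nat.find hex - 1, by omega⟩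
  have hnot : y ^ p ^ m' ∉ (⊥ : IntermediateField K M) := Nat.find_min hex (by omega)
  refine ⟨y ^ p ^ m', hnot, ?_⟩
  have hmem : (y ^ p ^ m') ^ p ∈ (⊥ : IntermediateField K M) := by
    rw [← pow_mul, ← pow_succ, ← hm']
    exact hm
  obtain ⟨b, hb⟩ := IntermediateField.mem_bot.mp hmem
  exact ⟨b, hb.symm⟩

/-- `[K(η) : K] = p` when `ηᵖ ∈ K`, `η ∉ K`, `char = p`. [folklore] -/
theorem finrank_adjoin_simple_eq_of_pow_eq {p : ℕ} (hp : p.Prime) [CharP M p] {η : M} {b : K}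
    (hη : η ^ p = algebraMap K M b) (hηK : η ∉ (⊥ : IntermediateField K M)) :
    Module.finrank K K⟮η⟯ = p := by
  haveI : Fact p.Prime := ⟨hp⟩
  have hint : IsIntegral K η := IsIntegral.of_pow hp.pos (hη ▸ isIntegral_algebraMap)
  have hirr : Irreducible (X ^ p - C b : K[X]) := by
    refine X_pow_sub_C_irreducible_of_prime hp fun c hc => hηK ?_
    have h0 : (η - algebraMap K M c) ^ p = 0 := by
      rw [sub_pow_char, hη, ← map_pow, hc, sub_self]
    have : η = algebraMap K M c := sub_eq_zero.mp (pow_eq_zero_iff hp.ne_zero |>.mp h0)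
    rw [this]
    exact IntermediateField.algebraMap_mem ⊥ c
  have hroot : aeval η (X ^ p - C b : K[X]) = 0 := by
    simp only [map_sub, map_pow, aeval_X, aeval_C, hη, sub_self]
  have hmin : minpoly K η = X ^ p - C b :=
    (minpoly.eq_of_irreducible_of_monic hirr hroot (monic_X_pow_sub_C b hp.ne_zero)).symm
  rw [IntermediateField.adjoin.finrank hint, hmin, natDegree_X_pow_sub_C]

/-- The generator of `K(η)` generates `K(η)` over `K` (as an intermediate field of
`K(η)/K`). [folklore] -/
theorem adjoin_simple_gen_eq_top (η : M) :
    K⟮IntermediateField.AdjoinSimple.gen K η⟯ = (⊤ : IntermediateField K K⟮η⟯) := by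
  apply IntermediateField.lift_injective
  rw [IntermediateField.lift_adjoin_simple, IntermediateField.lift_top]
  rfl

end FieldLemmas

section Climb

variable {k : Type u} [Field k]

/-- **The purely inseparable climb** (clause T-a(ii)′, PROVED): for `M/K` finite purely
inseparable over an imperfect ground field `k` of characteristic `p`, and any valuation ring
`W` of `M` containing `k`, the stage `(K, W ∩ K)` reaches `(M, W)` by `inseparableStep`s —
along `K ⊂ K(η₁) ⊂ K(η₁)(η₂) ⊂ ⋯`, `ηᵢᵖ` in the previous field.
[cite: CossartPiltant2008, Thm 7.2 proof (HAL p. 20)] -/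
theorem CReach3.of_isPurelyInseparable (p : ℕ) (hp : p.Prime) (hchar : CharP k p)
    (hkp : ¬ PerfectField k) :
    ∀ (n : ℕ) {K M : Type u} [Field K] [Algebra k K] [Field M] [Algebra K M] [Algebra k M]
      [IsScalarTower k K M] [FiniteDimensional K M] [IsPurelyInseparable K M],
      Module.finrank K M = n → ∀ (W : ValuationSubring M)
      (hkW : ∀ c : k, algebraMap k M c ∈ W),
      CReach3 k ⟨K, W.comap (algebraMap K M), forall_algebraMap_mem_comap hkW⟩ ⟨M, W, hkW⟩ := by
  intro n
  induction n using Nat.strong_induction_on with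
  | _ n ih =>
  intro K M _ _ _ _ _ _ _ _ hn W hkW
  haveI : Fact p.Prime := ⟨hp⟩
  haveI := hchar
  haveI : CharP K p := charP_of_injective_algebraMap (algebraMap k K).injective p
  haveI : CharP M p := charP_of_injective_algebraMap (algebraMap k M).injective p
  haveI : ExpChar K p := ExpChar.prime hp
  by_cases h1 : Module.finrank K M = 1
  · exact CReach3.of_finrank_eq_one h1 W hkW
  have hbt : (⊥ : IntermediateField K M) ≠ ⊤ := fun h =>
    h1 (IntermediateField.bot_eq_top_iff_finrank_eq_one.mp h)
  obtain ⟨η, hηK, b, hb⟩ := exists_not_mem_bot_pow_eq (K := K) (M := M) p hbt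
  -- the simple step `K' = K(η)` of degree `p`
  have hdegK' : Module.finrank K K⟮η⟯ = p := finrank_adjoin_simple_eq_of_pow_eq hp hb hηK
  have hη' : (IntermediateField.AdjoinSimple.gen K η) ^ p = algebraMap K K⟮η⟯ b :=
    Subtype.ext (by simpa using hb)
  haveI : IsScalarTower k K⟮η⟯ M := isScalarTower_intermediateField' (k := k) K⟮η⟯
  have step1 : CMove3 k ⟨K, W.comap (algebraMap K M), forall_algebraMap_mem_comap hkW⟩
      ⟨K⟮η⟯, W.comap (algebraMap K⟮η⟯ M), forall_algebraMap_mem_comap_intermediateField hkW K⟮η⟯⟩ :=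
    CMove3.inseparableStep (W.comap (algebraMap K M)) (forall_algebraMap_mem_comap hkW) p hp hchar
      hkp inferInstance hdegK' (IntermediateField.AdjoinSimple.gen K η) b hη'
      (adjoin_simple_gen_eq_top η) (W.comap (algebraMap K⟮η⟯ M))
      (forall_algebraMap_mem_comap_intermediateField hkW K⟮η⟯) (comap_comap_algebraMap K⟮η⟯ W)
  -- the rest of the climb, by induction (`[M : K(η)] < [M : K]`)
  have hlt : Module.finrank K⟮η⟯ M < n := by
    have hmul := Module.finrank_mul_finrank K K⟮η⟯ M
    rw [hdegK', hn] at hmul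
    have hpos : 0 < Module.finrank K⟮η⟯ M := Module.finrank_pos
    have h2 := hp.two_le
    nlinarith
  have step2 := ih _ hlt (K := K⟮η⟯) (M := M) rfl W hkW
  exact Relation.ReflTransGen.head step1 step2

/-- **The purely inseparable climb under the hypothesis of `GaloisTowerExists2008`**
(`PerfectField k → [M : K] = 1`, i.e. a separating transcendence basis was chosen when `k` is
perfect). [cite: CossartPiltant2008, Thm 7.2 proof (HAL p. 20); Matsumura Thm 26.3] -/
theorem CReach3.of_isPurelyInseparable' (p : ℕ) (hp : p.Prime) (hchar : CharP k p)
    {K M : Type u} [Field K] [Algebra k K] [Field M] [Algebra K M] [Algebra k M]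
    [IsScalarTower k K M] [FiniteDimensional K M] [IsPurelyInseparable K M]
    (hsep : PerfectField k → Module.finrank K M = 1) (W : ValuationSubring M)
    (hkW : ∀ c : k, algebraMap k M c ∈ W) :
    CReach3 k ⟨K, W.comap (algebraMap K M), forall_algebraMap_mem_comap hkW⟩ ⟨M, W, hkW⟩ := by
  by_cases hkp : PerfectField k
  · exact CReach3.of_finrank_eq_one (hsep hkp) W hkW
  · exact CReach3.of_isPurelyInseparable p hp hchar hkp _ rfl W hkW

/-- **The climb from the separable closure** `K₁` of `K₀` in `K` up to `K` (HAL p. 20: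
"Hence it can be assumed that `K = K₁`"), for `K/K₀` finite and any valuation ring `O` of `K`
containing `k`; when `k` is perfect one needs `K/K₀` separable (separating transcendence
basis). [cite: CossartPiltant2008, Thm 7.2 proof (HAL p. 20)] -/
theorem CReach3.separableClosure_top (p : ℕ) (hp : p.Prime) (hchar : CharP k p)
    {K₀ K : Type u} [Field K₀] [Algebra k K₀] [Field K] [Algebra K₀ K] [Algebra k K]
    [IsScalarTower k K₀ K] [FiniteDimensional K₀ K]
    (hsep : PerfectField k → Algebra.IsSeparable K₀ K) (O : ValuationSubring K)
    (hk : ∀ c : k, algebraMap k K c ∈ O) :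
    haveI : IsScalarTower k (separableClosure K₀ K) K :=
      isScalarTower_intermediateField' (k := k) (separableClosure K₀ K)
    CReach3 k ⟨separableClosure K₀ K, O.comap (algebraMap (separableClosure K₀ K) K),
      forall_algebraMap_mem_comap hk⟩ ⟨K, O, hk⟩ := by
  haveI : IsScalarTower k (separableClosure K₀ K) K :=
    isScalarTower_intermediateField' (k := k) (separableClosure K₀ K)
  refine CReach3.of_isPurelyInseparable' p hp hchar (fun hperf => ?_) O hk
  haveI := hsep hperf
  have htop : separableClosure K₀ K = ⊤ := (separableClosure.eq_top_iff K₀ K).mpr inferInstance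
  rw [← IntermediateField.finrank_top (F := K₀) (E := K)]
  exact congrArg (fun E : IntermediateField K₀ K => Module.finrank E K) htop

end Climb

end Literature.AlgebraicGeometry.CossartPiltant200819.CP2008
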